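import Mathlib
import HarnessLib
import Summits.ValiantsHypothesis.ValiantsHypothesis.Theses.MonotoneRestoration
import Literature.Computability.AlgebraicComplexity.ArithCircuit
import Literature.Computability.AlgebraicComplexity.ArithCircuitProofs
import Literature.Computability.AlgebraicComplexity.MonotoneStructure
import Literature.Computability.AlgebraicComplexity.PermanentIrreducible
import Literature.ModelTheory.FiniteModelTheory.CkEquiv
import Summits.ValiantsHypothesis.ValiantsHypothesis.Theorems.MonotoneRestorationMonotoneRestorationQPCosetCount
import Summits.ValiantsHypothesis.ValiantsHypothesis.Theorems.MonotoneRestorationMonotoneRestorationQPSymmetricLB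
import Summits.ValiantsHypothesis.ValiantsHypothesis.Theorems.MonotoneRestorationMonotoneRestorationQPSupportSymmetrisation
import Summits.ValiantsHypothesis.ValiantsHypothesis.Theorems.MonotoneRestorationMonotoneRestorationQPSparseRegime
import Summits.ValiantsHypothesis.ValiantsHypothesis.Theorems.MonotoneRestorationMonotoneRestorationQPBeta
import Literature.Computability.AlgebraicComplexity.SymmetricArithCircuit
import Literature.Computability.AlgebraicComplexity.DawarWilsenach2025Proofs
import Literature.GroupTheory.PermutationGroups.SmallIndexSubgroups
import Summits.ValiantsHypothesis.ValiantsHypothesis.Theorems.MonotoneRestorationQP.Negative.LoadBearing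
import Summits.ValiantsHypothesis.ValiantsHypothesis.Theorems.MonotoneRestorationMonotoneRestorationQPPermSupportCount

/-! TTRL-lite variant V19989 of stmt-ValiantsHypothesis-15886 -/

-- `Summit.ValiantsHypothesis.ValiantsHypothesis.…` is the tree's mandated single-conjunct layout
-- (Sub = Summit), so the duplicated namespace component is intended.
set_option linter.dupNamespace false

namespace Summit.ValiantsHypothesis.ValiantsHypothesis.Theorems

open Summit.ValiantsHypothesis.ValiantsHypothesis.Theses.MonotoneRestoration
open Literature.Computability.AlgebraicComplexity

/-- **Automorphisms fixing a gate permute its children and rename their values.**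
If `π` is a circuit automorphism extending the variable permutation `ρ` (acting diagonally on the
matrix positions `Fin n × Fin n`) and `π` fixes the gate `g`, then `π` maps every child `h` of `g`
to a child of `g`, and the polynomial computed at `π h` is the one at `h` with its variables
renamed by `p ↦ (ρ p.1, ρ p.2)` (`children_apply` at `g` plus `IsAutomorphismExtending.eval_apply`).
TTRL-lite variant V19989 supporting `stmt-ValiantsHypothesis-15886`. -/
theorem symmetricMonotone_var19989 :
    ∀ (n : ℕ) (G : Type) (C : LabelledArithCircuit NNReal (Fin n × Fin n) Unit G)
      (ρ : Equiv.Perm (Fin n)) (π : Equiv.Perm G) (g h : G),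
      C.IsAutomorphismExtending ρ π → π g = g → h ∈ C.children g →
        π h ∈ C.children g ∧
          C.eval (π h) = MvPolynomial.rename (fun p : Fin n × Fin n => (ρ p.1, ρ p.2)) (C.eval h) := by
  intro n G C ρ π g h hπ hg hh
  refine ⟨?_, ?_⟩
  · have hc := hπ.children_apply g
    rw [hg] at hc
    rw [hc, Finset.mem_map]
    exact ⟨h, hh, rfl⟩
  · exact hπ.eval_apply h

end Summit.ValiantsHypothesis.ValiantsHypothesis.Theorems
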